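import Summits.HodgeConjecture.HodgeConjecture.Statement
import Summits.HodgeConjecture.HodgeConjecture.Theses.RankFourFaces
import Summits.HodgeConjecture.HodgeConjecture.Theses.PadicSemiregularLift
import Literature.AlgebraicGeometry.HodgeTheory.HodgeGroupProductSemisimpleCMFactor
import HarnessLib

/-!
# Ring 2 · route `motiv` (generation 4) — the PRODUCT CELLS `X ~ A × C` (`C` of CM type) of the atlas axis: which rows need HC_CM, which do not, and exactness

HONEST FRAMING: research route conditional on HC_CM; not a corollary; Q11.4-sentence-2 already refuted in dim ≥ 3.

Cell `pub-hodge-ring2`, seat `pub-hodge-ring2-motiv-g4`. SUMMIT-SIDE binding of Part IV of the CM-factor product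
files, `Literature/AlgebraicGeometry/HodgeTheory/HodgeGroupProductCMFactorLowDim.lean` (p190383; Parts I–III are
bound in `Theorems/Ring2MotivProductCMFactor{,Classes}.lean`, `Theorems/Ring2MotivProductSemisimpleCMFactor.lean`).
The atlas axis of the cell (RING2-MAP `## §LEAD (gen 3)`, L3.3 / L3.5 / L3.7 / L3.10) indexes intermediate class
targets `HC_𝒞 := ∀ X, 𝒞 X → HodgeConjectureFor X.dim X.X` by (dimension `g ≤ 7`, endomorphism type, Hodge group);
its NON-SIMPLE cells WITH A CM FACTOR whose Hodge group splits off that factor are served here by ONE parametrised,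
isogeny-closed cell shape

  `ProdCMCell 𝒜 𝒞 X := ∃ A C, X ~ A × C ∧ 𝒜 A ∧ IsOfCMType C ∧ 𝒞 C`,

`𝒜` a class of left factors, `𝒞` a class of CM right factors, together with the cell's SPLITTING HYPOTHESIS
`CellProductSpan 𝒜 := ∀ A C, 𝒜 A → IsOfCMType C → HodgeClassesProductSpan A C` (the Hodge classes of `A × C`
are spanned by exterior products of Hodge classes of the factors), which the two printed facts of Parts I / III
provide on `𝒜 ⊆ {A without type-IV factor}` (Lombardo 2016 Lemma 3.4, after Moonen–Zarhin 1999 (3.1)) and on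
`𝒜 ⊆ {Hg(A) semisimple}` (Gordon 1999 App. B §3) — both HYPOTHESES naming theorems in print. Every class target is
written OUT as `∀ X, 𝒞 X → HodgeConjectureFor X.dim X.X`; this is, definitionally, `ClassTargets.HCOnClass 𝒞` of
the frame `Theorems/Ring2ClassTargets.lean` (p190400), which this file deliberately does not import (L3.14 (b): the
frame's `hcOnClass_*` links are one-liners filed by LEAD once its olean is built). Rows (all dimensions; the atlas
restricts to `g ≤ 7` by monotonicity):
* §2 KIND = ABSENT (no `HC_CM` binder): `𝒞 = (dim ≤ 3)` and `𝒞 = IsDivisorGenerated`: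
  `CellProductSpan 𝒜 → HC_𝒜 → HC_(ProdCMCell 𝒜 𝒞)`; CLOSED outright (modulo the splitting fact) when moreover
  `𝒜 ⊆ (dim ≤ 3)` or `𝒜 ⊆ IsDivisorGenerated` or `𝒜 ⊆` (powers of a simple abelian variety of prime dimension
  without type-IV factor; Tankeev–Ribet as a further binder); REDUCED to HC in dimension `≤ 5` (the tree's row
  `HCUpToDim 5 ↔ Theses.SevenfoldWeilCensus.HodgeAbelianDimLeFive`, stmt-HodgeConjecture-18723) when `𝒜 ⊆ (dim ≤ 5)`
  — so the `g = 6, 7, 8` product cells "(split class, `dim ≤ 5`) × (CM, `dim ≤ 3`)" are worth NO MORE than row `g ≤ 5`;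
* §3 KIND = LOAD-BEARING: arbitrary CM factor, `HC_CM → CellProductSpan 𝒜 → HC_𝒜 → HC_(ProdCMCell 𝒜 𝒞)`;
* §4 EXACTNESS at cell level (E4/E5 of Part III lifted to classes): on a cell with a witness on each side,
  `HC_(ProdCMCell 𝒜 𝒞) ↔ HC_𝒜 ∧ HC_(IsOfCMType ⊓ 𝒞)`, and for `𝒞 = ⊤`: `HC_(ProdCMCell 𝒜 ⊤) ↔ HC_𝒜 ∧ HC_CM` — the
  product cells over a fixed non-empty split class `𝒜` are worth EXACTLY `HC_CM` plus HC on `𝒜`; `HC_CM` can be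
  neither dropped nor weakened there; on the `dim C ≤ 3` cell `HC_(cell) ↔ HC_𝒜` (KIND ABSENT, exactly);
* §1 ON-PATH: every cell from `HC_AV` (item stmt-HodgeConjecture-1333) and from the summit statement.
What is NOT here (RING2-MAP `## §motiv (gen 4)`, blocks II–III): the product cells whose Hodge group does NOT
split off the CM factor — `A` with a simple type-IV factor on whose tangent space the centre field acts with
non-Weil multiplicities and whose central torus bonds with `Hg(C)` (Moonen–Zarhin 1999 cases (a), (e), (f), (g) and
their analogues in dimension 6, 7): there Weil-type Hodge classes live ACROSS the factors,
`HodgeClassesProductSpan A C` FAILS (Part IV's boundary fact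
`MoonenZarhin1999_exists_typeIV_threefold_prod_cmCurve_not_productSpan`), and no theorem of this file applies;
and the all-CM cells, which ARE `HC_CM`.

`HC_CM` := `Theses.RankFourFaces.CMAbelianHodge` (item stmt-HodgeConjecture-3052; it unfolds to
`∀ B, Milne1999.CMHodgeHypothesisAt B`) is a HYPOTHESIS (binder by name) wherever it occurs. No new named fact, no
`sorry`, no summit-side copy of any hypothesis; the two `def`s are parametrised cell shapes (nothing asserted).

References (bib keys): Gordon1999HodgeAVSurvey (App. B §3), Lombardo2016 (Lemma 3.4), MoonenZarhin1999LowDim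
(Thm. 0.1, §1, §3 (3.1), (3.6)–(3.8), §5), vanGeemen1994HodgeAV (Lemma 3.7, Thm. 4.6), Milne1999 (§7 (H)),
Deligne2000 (§1), Fulton1998 (Example 10.1.2), Tankeev1983, Ribet1983.
-/

set_option linter.dupNamespace false

namespace Summit.HodgeConjecture.HodgeConjecture.Ring2.Motiv

open CategoryTheory
open Literature.AlgebraicGeometry Literature.AlgebraicGeometry.Motives
open Literature.AlgebraicGeometry.HodgeTheory
open Literature.AlgebraicGeometry.Milne1999
open Summit.HodgeConjecture.HodgeConjecture.Theses

/-! ## §0 The cell shape and its splitting hypothesis -/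

/-- **The product cell `𝒜 × (CM ∩ 𝒞)`, isogeny-closed**: `X` is isogenous to some `A × C` with `𝒜 A`, `C` of CM
type and `𝒞 C`. A parametrised class of complex abelian varieties (nothing asserted).
[cite: MoonenZarhin1999LowDim, §3 (3.1)] -/
def ProdCMCell (𝒜 𝒞 : AbelianVariety ℂ → Prop) (X : AbelianVariety ℂ) : Prop :=
  ∃ A C : AbelianVariety ℂ, AbelianVariety.IsIsogenous X (A.prod C) ∧ 𝒜 A ∧ IsOfCMType C ∧ 𝒞 C

/-- **The cell's splitting hypothesis**: for every `A ∈ 𝒜` and every `C` of CM type the Hodge classes of `A × C`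
are spanned by exterior products of Hodge classes of the factors (Part I's `HodgeClassesProductSpan`; in print the
consequence of `Hg(A × C) = Hg(A) × Hg(C)`, Moonen–Zarhin 1999 (3.1) with (1.8)). A parametrised hypothesis SHAPE —
instances come from the printed facts of Parts I / III (`cellProductSpan_of_lombardo`, `cellProductSpan_of_gordon`).
[cite: MoonenZarhin1999LowDim, §3 (3.1)] -/
def CellProductSpan (𝒜 : AbelianVariety ℂ → Prop) : Prop :=
  ∀ A C : AbelianVariety ℂ, 𝒜 A → IsOfCMType C → HodgeClassesProductSpan A C

variable {𝒜 𝒜' 𝒞 𝒞' : AbelianVariety ℂ → Prop}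

/-- A strict product of the cell lies in the cell. [folklore] -/
theorem prodCMCell_prod {A C : AbelianVariety ℂ} (hA : 𝒜 A) (hCt : IsOfCMType C) (hC : 𝒞 C) :
    ProdCMCell 𝒜 𝒞 (A.prod C) :=
  ⟨A, C, AbelianVariety.IsIsogenous.refl _, hA, hCt, hC⟩

/-- The cell is isogeny-closed. [cite: vanGeemen1994HodgeAV, §3.7 Lemma 3.7] -/
theorem prodCMCell_of_isIsogenous {X Y : AbelianVariety ℂ} (hXY : AbelianVariety.IsIsogenous X Y)
    (hY : ProdCMCell 𝒜 𝒞 Y) : ProdCMCell 𝒜 𝒞 X := by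
  obtain ⟨A, C, hYi, hA, hCt, hC⟩ := hY
  exact ⟨A, C, hXY.trans hYi, hA, hCt, hC⟩

/-- Monotonicity of the cell in both parameters. [folklore] -/
theorem prodCMCell_mono (h𝒜 : ∀ A, 𝒜 A → 𝒜' A) (h𝒞 : ∀ C, 𝒞 C → 𝒞' C) {X : AbelianVariety ℂ}
    (hX : ProdCMCell 𝒜 𝒞 X) : ProdCMCell 𝒜' 𝒞' X := by
  obtain ⟨A, C, hXi, hA, hCt, hC⟩ := hX
  exact ⟨A, C, hXi, h𝒜 A hA, hCt, h𝒞 C hC⟩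

/-- Monotonicity of the splitting hypothesis. [folklore] -/
theorem cellProductSpan_mono (h𝒜 : ∀ A, 𝒜 A → 𝒜' A) (h : CellProductSpan 𝒜') : CellProductSpan 𝒜 :=
  fun A C hA hCt ↦ h A C (h𝒜 A hA) hCt

/-- **Instance 1 (Parts I–II): `𝒜 ⊆ {A without simple factor of type IV}`**, from Lombardo 2016 Lemma 3.4
(binder `hL`, a theorem in print). [cite: Lombardo2016, Lemma 3.4 (p. 1229)] [cite: MoonenZarhin1999LowDim, §3 (3.1)] -/
theorem cellProductSpan_of_lombardo (hL : Lombardo2016_hodgeClassesProductSpan)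
    (h𝒜4 : ∀ A, 𝒜 A → HasNoTypeIVFactor A) : CellProductSpan 𝒜 :=
  fun A C hA hCt ↦ hL A C (h𝒜4 A hA) hCt

/-- **Instance 2 (Part III): `𝒜 ⊆ {Hg(A) semisimple}`** (type IV with Weil multiplicities allowed), from Gordon 1999
App. B §3 (binder `hG`, a theorem in print). [cite: Gordon1999HodgeAVSurvey, App. B §3 (pp. 13–14)] -/
theorem cellProductSpan_of_gordon (hG : Gordon1999_hodgeClassesProductSpan_of_semisimple)
    (h𝒜s : ∀ A, 𝒜 A → HasSemisimpleHodgeGroup A) : CellProductSpan 𝒜 :=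
  fun A C hA hCt ↦ hG A C (h𝒜s A hA) hCt

/-- Pointwise-to-class lift: HC on every strict product of the cell gives HC on the (isogeny-closed) cell.
[cite: vanGeemen1994HodgeAV, §3.7 Lemma 3.7] -/
theorem hodgeConjectureFor_of_prodCMCell_of_forall_prod
    (h : ∀ A C : AbelianVariety ℂ, 𝒜 A → IsOfCMType C → 𝒞 C →
      HodgeConjectureFor (A.prod C).dim (A.prod C).X)
    {X : AbelianVariety ℂ} (hX : ProdCMCell 𝒜 𝒞 X) : HodgeConjectureFor X.dim X.X := by
  obtain ⟨A, C, hXi, hA, hCt, hC⟩ := hX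
  exact HodgeConjectureFor.of_isIsogenous hXi (h A C hA hCt hC)

/-! ## §1 On path (mandatory, free) -/

/-- **ON-PATH: `HC_AV → HC(cell)`** (item stmt-HodgeConjecture-1333 by name). [cite: Deligne2000, §1] -/
theorem hodgeConjectureFor_of_prodCMCell_of_hodgeAbelianVarieties (h : PadicSemiregularLift.HodgeAbelianVarieties)
    {X : AbelianVariety ℂ} (_hX : ProdCMCell 𝒜 𝒞 X) : HodgeConjectureFor X.dim X.X :=
  h X

/-- **ON-PATH: the summit statement `HodgeConjecture → HC(cell)`** (through Part III's
`hodgeConjectureFor_of_hodgeConjecture'`). [cite: Deligne2000, §1] -/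
theorem hodgeConjectureFor_of_prodCMCell_of_hodgeConjecture (h : _root_.HodgeConjecture)
    {X : AbelianVariety ℂ} (_hX : ProdCMCell 𝒜 𝒞 X) : HodgeConjectureFor X.dim X.X :=
  hodgeConjectureFor_of_hodgeConjecture' h X

/-! ## §2 KIND = ABSENT: rows without `HC_CM` -/

/-- **CM factor of dimension `≤ 3` — no `HC_CM`.** On a split class `𝒜` satisfying HC, every `X ~ A × C` with
`A ∈ 𝒜` and `C` of CM type of dimension `≤ 3` satisfies HC: HC(`C`) is the tree's unconditional
`hodgeConjectureFor_of_dim_le_three_holds`. Atlas cells (dim `A`, dim `C`) = (a, c ≤ 3), `a + c ≤ 7`, split.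
[cite: MoonenZarhin1999LowDim, §3 (3.1) and Thm. (3.2)] [cite: Gordon1999HodgeAVSurvey, App. B §3] -/
theorem hodgeConjectureFor_of_prodCMCell_cm_dim_le_three (hS : CellProductSpan 𝒜)
    (h𝒜 : ∀ A : AbelianVariety ℂ, 𝒜 A → HodgeConjectureFor A.dim A.X)
    {X : AbelianVariety ℂ} (hX : ProdCMCell 𝒜 (fun C ↦ C.dim ≤ 3) X) : HodgeConjectureFor X.dim X.X := by
  refine hodgeConjectureFor_of_prodCMCell_of_forall_prod (fun A C hA hCt hC3 ↦ ?_) hX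
  exact hodgeConjectureFor_prod_of_productSpan A C (hS A C hA hCt) (h𝒜 A hA)
    (hodgeConjectureFor_of_dim_le_three_holds hC3 AbelianVariety.isSmoothProjective_holds)

/-- **CM factor with divisor-generated Hodge ring — no `HC_CM`** (e.g. a power of a CM elliptic curve, a simple CM
abelian variety of prime dimension, a CM abelian variety with nondegenerate Hodge group).
[cite: vanGeemen1994HodgeAV, Thm. 4.6] [cite: Gordon1999HodgeAVSurvey, App. B §3] -/
theorem hodgeConjectureFor_of_prodCMCell_isDivisorGenerated (hS : CellProductSpan 𝒜)
    (h𝒜 : ∀ A : AbelianVariety ℂ, 𝒜 A → HodgeConjectureFor A.dim A.X)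
    {X : AbelianVariety ℂ} (hX : ProdCMCell 𝒜 IsDivisorGenerated X) : HodgeConjectureFor X.dim X.X := by
  refine hodgeConjectureFor_of_prodCMCell_of_forall_prod (fun A C hA hCt hCD ↦ ?_) hX
  exact hodgeConjectureFor_prod_of_productSpan A C (hS A C hA hCt) (h𝒜 A hA)
    (hodgeConjectureFor_of_isDivisorGenerated C hCD)

/-- **Both factors of dimension `≤ 3` — CLOSED** modulo the splitting hypothesis (atlas cells (a ≤ 3, c ≤ 3), so
`g ≤ 6`, split). [cite: MoonenZarhin1999LowDim, Thm. (3.2) and §5] -/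
theorem hodgeConjectureFor_of_prodCMCell_dim_le_three_cm_dim_le_three (hS : CellProductSpan 𝒜)
    (h𝒜3 : ∀ A, 𝒜 A → A.dim ≤ 3)
    {X : AbelianVariety ℂ} (hX : ProdCMCell 𝒜 (fun C ↦ C.dim ≤ 3) X) : HodgeConjectureFor X.dim X.X :=
  hodgeConjectureFor_of_prodCMCell_cm_dim_le_three hS
    (fun A hA ↦ hodgeConjectureFor_of_dim_le_three_holds (h𝒜3 A hA) AbelianVariety.isSmoothProjective_holds) hX

/-- **Left factor divisor-generated, CM factor of dimension `≤ 3` — CLOSED** modulo the splitting hypothesis.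
[cite: vanGeemen1994HodgeAV, Thm. 4.6] -/
theorem hodgeConjectureFor_of_prodCMCell_isDivisorGenerated_cm_dim_le_three (hS : CellProductSpan 𝒜)
    (h𝒜D : ∀ A, 𝒜 A → IsDivisorGenerated A)
    {X : AbelianVariety ℂ} (hX : ProdCMCell 𝒜 (fun C ↦ C.dim ≤ 3) X) : HodgeConjectureFor X.dim X.X :=
  hodgeConjectureFor_of_prodCMCell_cm_dim_le_three hS
    (fun A hA ↦ hodgeConjectureFor_of_isDivisorGenerated A (h𝒜D A hA)) hX

/-- **Left factor of dimension `≤ 5`, CM factor of dimension `≤ 3` — REDUCED to HC in dimension `≤ 5`** (binder `h5`;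
in the tree this is the row `ClassTargets.HCUpToDim 5`, `↔` item stmt-HodgeConjecture-18723, and it follows from
Moonen–Zarhin (0.1)/(0.2) + Weil classes on Weil-type fourfolds): the split product cells of dimension `6, 7, 8` of
this shape carry NO content beyond dimension `≤ 5`. [cite: MoonenZarhin1999LowDim, Thms. 0.1, 0.2] -/
theorem hodgeConjectureFor_of_prodCMCell_dim_le_five_cm_dim_le_three (hS : CellProductSpan 𝒜)
    (h𝒜5 : ∀ A, 𝒜 A → A.dim ≤ 5)
    (h5 : ∀ A : AbelianVariety ℂ, A.dim ≤ 5 → HodgeConjectureFor A.dim A.X)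
    {X : AbelianVariety ℂ} (hX : ProdCMCell 𝒜 (fun C ↦ C.dim ≤ 3) X) : HodgeConjectureFor X.dim X.X :=
  hodgeConjectureFor_of_prodCMCell_cm_dim_le_three hS (fun A hA ↦ h5 A (h𝒜5 A hA)) hX

/-- **Left factor isogenous to a power of a simple abelian variety of PRIME dimension WITHOUT type-IV factor, CM
factor of dimension `≤ 3` — CLOSED** modulo Tankeev–Ribet (refereed, binder `h`) and Lombardo's fact (binder `hL`).
(A simple type-IV abelian variety of odd prime dimension never has semisimple Hodge group, so the type-IV
prime-dimension cells are NOT split in general: RING2-MAP `## §motiv (gen 4)` block II.)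
[cite: MoonenZarhin1999LowDim, §2 Thm. (2.7)] [cite: Lombardo2016, Lemma 3.4] -/
theorem hodgeConjectureFor_of_prodCMCell_powSimplePrimeDim_noTypeIV_cm_dim_le_three
    (h : TankeevRibet1983_hodgeClasses_divisorial_powers_simplePrimeDimension)
    (hL : Lombardo2016_hodgeClassesProductSpan) {X : AbelianVariety ℂ}
    (hX : ProdCMCell (fun B ↦ HasNoTypeIVFactor B ∧ ∃ (Y : AbelianVariety ℂ) (N : ℕ),
      Y.IsSimple ∧ Y.dim.Prime ∧ AbelianVariety.IsIsogenous B (Y.powSucc N)) (fun C ↦ C.dim ≤ 3) X) :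
    HodgeConjectureFor X.dim X.X := by
  refine hodgeConjectureFor_of_prodCMCell_cm_dim_le_three (cellProductSpan_of_lombardo hL fun B hB ↦ ?_)
    (fun B hB ↦ ?_) hX
  · exact hB.1
  · obtain ⟨Y, N, hYs, hYp, hBi⟩ := hB.2
    exact HodgeConjectureFor.of_isIsogenous hBi
      (hodgeConjectureFor_of_isDivisorGenerated _ (isDivisorGenerated_powSucc_of_tankeevRibet h Y hYp rfl hYs N))

/-- Row §2 (CM factor `dim ≤ 3`) on the SEMISIMPLE class, Gordon's fact as the binder (Part IV
`hodgeConjectureFor_of_isIsogenous_prod_of_semisimple_of_cm_dim_le_three`, classwise).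
[cite: Gordon1999HodgeAVSurvey, App. B §3] -/
theorem hodgeConjectureFor_of_prodCMCell_semisimple_cm_dim_le_three_of_gordon
    (hG : Gordon1999_hodgeClassesProductSpan_of_semisimple)
    (h𝒜 : ∀ A : AbelianVariety ℂ, 𝒜 A ∧ HasSemisimpleHodgeGroup A → HodgeConjectureFor A.dim A.X)
    {X : AbelianVariety ℂ} (hX : ProdCMCell (fun A ↦ 𝒜 A ∧ HasSemisimpleHodgeGroup A) (fun C ↦ C.dim ≤ 3) X) :
    HodgeConjectureFor X.dim X.X := by
  refine hodgeConjectureFor_of_prodCMCell_cm_dim_le_three (cellProductSpan_of_gordon hG fun A hA ↦ ?_) h𝒜 hX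
  exact hA.2

/-- Row §2 (CM factor `dim ≤ 3`) on the NO-TYPE-IV class, Lombardo's fact as the binder.
[cite: Lombardo2016, Lemma 3.4] -/
theorem hodgeConjectureFor_of_prodCMCell_noTypeIV_cm_dim_le_three_of_lombardo
    (hL : Lombardo2016_hodgeClassesProductSpan)
    (h𝒜 : ∀ A : AbelianVariety ℂ, 𝒜 A ∧ HasNoTypeIVFactor A → HodgeConjectureFor A.dim A.X)
    {X : AbelianVariety ℂ} (hX : ProdCMCell (fun A ↦ 𝒜 A ∧ HasNoTypeIVFactor A) (fun C ↦ C.dim ≤ 3) X) :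
    HodgeConjectureFor X.dim X.X := by
  refine hodgeConjectureFor_of_prodCMCell_cm_dim_le_three (cellProductSpan_of_lombardo hL fun A hA ↦ ?_) h𝒜 hX
  exact hA.2

/-! ## §3 KIND = LOAD-BEARING: arbitrary CM factor, `HC_CM` by name -/

/-- **HC on the full product cell from `HC_CM`** (binder `hCM` = item stmt-HodgeConjecture-3052 by name): on a split
class `𝒜` satisfying HC, every `X ~ A × C`, `A ∈ 𝒜`, `C` of CM type (any dimension, any `𝒞`), satisfies HC.
`HC_CM` is used exactly once per member, at `C`. [cite: Milne1999, §7 (H)] [cite: MoonenZarhin1999LowDim, §3 (3.1)] -/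
theorem hodgeConjectureFor_of_prodCMCell_of_cmAbelianHodge (hCM : RankFourFaces.CMAbelianHodge)
    (hS : CellProductSpan 𝒜) (h𝒜 : ∀ A : AbelianVariety ℂ, 𝒜 A → HodgeConjectureFor A.dim A.X)
    {X : AbelianVariety ℂ} (hX : ProdCMCell 𝒜 𝒞 X) : HodgeConjectureFor X.dim X.X := by
  refine hodgeConjectureFor_of_prodCMCell_of_forall_prod (fun A C hA hCt _ ↦ ?_) hX
  exact hodgeConjectureFor_prod_of_productSpan A C (hS A C hA hCt) (h𝒜 A hA)
    (hCM C AbelianVariety.isSmoothProjective_holds hCt)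

/-- §3 on the SEMISIMPLE class (Part III `hodgeConjectureFor_of_isIsogenous_prod_of_semisimple_of_cmHodgeHypothesis`,
classwise). [cite: Gordon1999HodgeAVSurvey, App. B §3] [cite: Milne1999, §7 (H)] -/
theorem hodgeConjectureFor_of_prodCMCell_semisimple_of_cmAbelianHodge_of_gordon
    (hCM : RankFourFaces.CMAbelianHodge) (hG : Gordon1999_hodgeClassesProductSpan_of_semisimple)
    (h𝒜 : ∀ A : AbelianVariety ℂ, 𝒜 A ∧ HasSemisimpleHodgeGroup A → HodgeConjectureFor A.dim A.X)
    {X : AbelianVariety ℂ} (hX : ProdCMCell (fun A ↦ 𝒜 A ∧ HasSemisimpleHodgeGroup A) 𝒞 X) :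
    HodgeConjectureFor X.dim X.X := by
  refine hodgeConjectureFor_of_prodCMCell_of_cmAbelianHodge hCM (cellProductSpan_of_gordon hG fun A hA ↦ ?_) h𝒜 hX
  exact hA.2

/-- §3 on the NO-TYPE-IV class (Part III `hodgeConjectureFor_of_isIsogenous_prod_of_cmHodgeHypothesis`, classwise).
[cite: Lombardo2016, Lemma 3.4] [cite: Milne1999, §7 (H)] -/
theorem hodgeConjectureFor_of_prodCMCell_noTypeIV_of_cmAbelianHodge_of_lombardo
    (hCM : RankFourFaces.CMAbelianHodge) (hL : Lombardo2016_hodgeClassesProductSpan)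
    (h𝒜 : ∀ A : AbelianVariety ℂ, 𝒜 A ∧ HasNoTypeIVFactor A → HodgeConjectureFor A.dim A.X)
    {X : AbelianVariety ℂ} (hX : ProdCMCell (fun A ↦ 𝒜 A ∧ HasNoTypeIVFactor A) 𝒞 X) :
    HodgeConjectureFor X.dim X.X := by
  refine hodgeConjectureFor_of_prodCMCell_of_cmAbelianHodge hCM (cellProductSpan_of_lombardo hL fun A hA ↦ ?_) h𝒜 hX
  exact hA.2

/-! ## §4 EXACTNESS at cell level -/

/-- **Descent to the left factors**: HC on the cell gives HC on `𝒜`, given ONE CM member of `𝒞` to multiply with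
(unconditional: Part II `hodgeConjectureFor_left_of_prod`). [cite: Fulton1998, §10.1 Example 10.1.2] -/
theorem hodgeConjectureFor_left_of_prodCMCell (hC₀ : ∃ C : AbelianVariety ℂ, IsOfCMType C ∧ 𝒞 C)
    (h : ∀ X : AbelianVariety ℂ, ProdCMCell 𝒜 𝒞 X → HodgeConjectureFor X.dim X.X)
    (A : AbelianVariety ℂ) (hA : 𝒜 A) : HodgeConjectureFor A.dim A.X := by
  obtain ⟨C, hCt, hC⟩ := hC₀
  exact hodgeConjectureFor_left_of_prod A C (h _ (prodCMCell_prod hA hCt hC))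

/-- **Descent to the CM factors**: HC on the cell gives HC on `IsOfCMType ⊓ 𝒞`, given ONE member of `𝒜`
(unconditional: Part II `hodgeConjectureFor_right_of_prod`). [cite: Fulton1998, §10.1 Example 10.1.2] -/
theorem hodgeConjectureFor_right_of_prodCMCell (hA₀ : ∃ A : AbelianVariety ℂ, 𝒜 A)
    (h : ∀ X : AbelianVariety ℂ, ProdCMCell 𝒜 𝒞 X → HodgeConjectureFor X.dim X.X)
    (C : AbelianVariety ℂ) (hCt : IsOfCMType C) (hC : 𝒞 C) : HodgeConjectureFor C.dim C.X := by
  obtain ⟨A, hA⟩ := hA₀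
  exact hodgeConjectureFor_right_of_prod A C (h _ (prodCMCell_prod hA hCt hC))

/-- **`HC_CM` back from the full cell** (`𝒞 = ⊤`), given one member of `𝒜`: on a non-empty split class the product
cells cannot be closed with anything weaker than `HC_CM`. [cite: Milne1999, §7 (H)] -/
theorem cmAbelianHodge_of_forall_prodCMCell_top (hA₀ : ∃ A : AbelianVariety ℂ, 𝒜 A)
    (h : ∀ X : AbelianVariety ℂ, ProdCMCell 𝒜 (fun _ ↦ True) X → HodgeConjectureFor X.dim X.X) :
    RankFourFaces.CMAbelianHodge := by
  intro C _ hCt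
  exact hodgeConjectureFor_right_of_prodCMCell hA₀ h C hCt trivial

/-- **Assembly from the factor classes** on a split class. [cite: MoonenZarhin1999LowDim, §3 (3.1)] -/
theorem hodgeConjectureFor_of_prodCMCell_of_left_of_right (hS : CellProductSpan 𝒜)
    (h𝒜 : ∀ A : AbelianVariety ℂ, 𝒜 A → HodgeConjectureFor A.dim A.X)
    (h𝒞 : ∀ C : AbelianVariety ℂ, IsOfCMType C → 𝒞 C → HodgeConjectureFor C.dim C.X)
    {X : AbelianVariety ℂ} (hX : ProdCMCell 𝒜 𝒞 X) : HodgeConjectureFor X.dim X.X := by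
  refine hodgeConjectureFor_of_prodCMCell_of_forall_prod (fun A C hA hCt hC ↦ ?_) hX
  exact hodgeConjectureFor_prod_of_productSpan A C (hS A C hA hCt) (h𝒜 A hA) (h𝒞 C hCt hC)

/-- **EXACTNESS of the product cell** (split class, a witness on each side):
`HC(𝒜 × (CM ∩ 𝒞)) ↔ HC(𝒜) ∧ HC(CM ∩ 𝒞)`. [cite: MoonenZarhin1999LowDim, §3 (3.1)] [cite: Fulton1998, §10.1 Example 10.1.2] -/
theorem forall_prodCMCell_iff (hS : CellProductSpan 𝒜) (hA₀ : ∃ A : AbelianVariety ℂ, 𝒜 A)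
    (hC₀ : ∃ C : AbelianVariety ℂ, IsOfCMType C ∧ 𝒞 C) :
    (∀ X : AbelianVariety ℂ, ProdCMCell 𝒜 𝒞 X → HodgeConjectureFor X.dim X.X) ↔
      (∀ A : AbelianVariety ℂ, 𝒜 A → HodgeConjectureFor A.dim A.X) ∧
        ∀ C : AbelianVariety ℂ, IsOfCMType C → 𝒞 C → HodgeConjectureFor C.dim C.X :=
  ⟨fun h ↦ ⟨hodgeConjectureFor_left_of_prodCMCell hC₀ h, hodgeConjectureFor_right_of_prodCMCell hA₀ h⟩,
    fun h _ hX ↦ hodgeConjectureFor_of_prodCMCell_of_left_of_right hS h.1 h.2 hX⟩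

/-- **EXACTNESS against `HC_CM`** (`𝒞 = ⊤`; split class with a member, one abelian variety of CM type in the
universe): `HC(𝒜 × CM) ↔ HC(𝒜) ∧ HC_CM` — KIND of `HC_CM` on the full product cell over `𝒜` = LOAD-BEARING, EXACTLY.
[cite: Milne1999, §7 (H)] [cite: MoonenZarhin1999LowDim, §3 (3.1)] -/
theorem forall_prodCMCell_top_iff (hS : CellProductSpan 𝒜) (hA₀ : ∃ A : AbelianVariety ℂ, 𝒜 A)
    (hC₀ : ∃ C : AbelianVariety ℂ, IsOfCMType C) :
    (∀ X : AbelianVariety ℂ, ProdCMCell 𝒜 (fun _ ↦ True) X → HodgeConjectureFor X.dim X.X) ↔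
      (∀ A : AbelianVariety ℂ, 𝒜 A → HodgeConjectureFor A.dim A.X) ∧ RankFourFaces.CMAbelianHodge := by
  refine ⟨fun h ↦ ⟨hodgeConjectureFor_left_of_prodCMCell (𝒞 := fun _ ↦ True) ?_ h,
      cmAbelianHodge_of_forall_prodCMCell_top hA₀ h⟩,
    fun h _ hX ↦ hodgeConjectureFor_of_prodCMCell_of_cmAbelianHodge h.2 hS h.1 hX⟩
  obtain ⟨C, hCt⟩ := hC₀
  exact ⟨C, hCt, trivial⟩

/-- **EXACTNESS on the `dim C ≤ 3` cell**: there `HC(cell) ↔ HC(𝒜)` — the CM side is unconditional, so these cells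
are worth exactly HC on the left class (KIND of `HC_CM` = ABSENT, exactly). [cite: MoonenZarhin1999LowDim, §3 (3.1)] -/
theorem forall_prodCMCell_cm_dim_le_three_iff (hS : CellProductSpan 𝒜)
    (hC₀ : ∃ C : AbelianVariety ℂ, IsOfCMType C ∧ C.dim ≤ 3) :
    (∀ X : AbelianVariety ℂ, ProdCMCell 𝒜 (fun C ↦ C.dim ≤ 3) X → HodgeConjectureFor X.dim X.X) ↔
      ∀ A : AbelianVariety ℂ, 𝒜 A → HodgeConjectureFor A.dim A.X :=
  ⟨fun h ↦ hodgeConjectureFor_left_of_prodCMCell hC₀ h,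
    fun h _ hX ↦ hodgeConjectureFor_of_prodCMCell_cm_dim_le_three hS h hX⟩

/-- The semisimple instance of the exactness against `HC_CM` (Part III E4/E5, classwise).
[cite: Gordon1999HodgeAVSurvey, App. B §3] [cite: Milne1999, §7 (H)] -/
theorem forall_prodCMCell_semisimple_top_iff_of_gordon
    (hG : Gordon1999_hodgeClassesProductSpan_of_semisimple)
    (hA₀ : ∃ A : AbelianVariety ℂ, 𝒜 A ∧ HasSemisimpleHodgeGroup A)
    (hC₀ : ∃ C : AbelianVariety ℂ, IsOfCMType C) :
    (∀ X : AbelianVariety ℂ, ProdCMCell (fun A ↦ 𝒜 A ∧ HasSemisimpleHodgeGroup A) (fun _ ↦ True) X →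
        HodgeConjectureFor X.dim X.X) ↔
      (∀ A : AbelianVariety ℂ, 𝒜 A ∧ HasSemisimpleHodgeGroup A → HodgeConjectureFor A.dim A.X) ∧
        RankFourFaces.CMAbelianHodge :=
  forall_prodCMCell_top_iff (cellProductSpan_of_gordon hG fun _ hA ↦ hA.2) hA₀ hC₀

/-- The no-type-IV instance of the exactness against `HC_CM` (Part II E_M, classwise).
[cite: Lombardo2016, Lemma 3.4] [cite: Milne1999, §7 (H)] -/
theorem forall_prodCMCell_noTypeIV_top_iff_of_lombardo
    (hL : Lombardo2016_hodgeClassesProductSpan)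
    (hA₀ : ∃ A : AbelianVariety ℂ, 𝒜 A ∧ HasNoTypeIVFactor A)
    (hC₀ : ∃ C : AbelianVariety ℂ, IsOfCMType C) :
    (∀ X : AbelianVariety ℂ, ProdCMCell (fun A ↦ 𝒜 A ∧ HasNoTypeIVFactor A) (fun _ ↦ True) X →
        HodgeConjectureFor X.dim X.X) ↔
      (∀ A : AbelianVariety ℂ, 𝒜 A ∧ HasNoTypeIVFactor A → HodgeConjectureFor A.dim A.X) ∧
        RankFourFaces.CMAbelianHodge :=
  forall_prodCMCell_top_iff (cellProductSpan_of_lombardo hL fun _ hA ↦ hA.2) hA₀ hC₀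

/-! ## §5 Audit: everything here follows from the summit statement -/

/-- Audit: under `HodgeConjecture` every row of this file holds (the cells are ON the summit's path, never beside it).
[cite: Deligne2000, §1] -/
theorem prodCMCell_rows_of_hodgeConjecture (h : _root_.HodgeConjecture) (𝒜 𝒞 : AbelianVariety ℂ → Prop) :
    (∀ X : AbelianVariety ℂ, ProdCMCell 𝒜 𝒞 X → HodgeConjectureFor X.dim X.X) ∧
      (∀ A : AbelianVariety ℂ, 𝒜 A → HodgeConjectureFor A.dim A.X) ∧ RankFourFaces.CMAbelianHodge := by
  refine ⟨fun X _ ↦ hodgeConjectureFor_of_hodgeConjecture' h X,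
    fun A _ ↦ hodgeConjectureFor_of_hodgeConjecture' h A, ?_⟩
  intro C _ _
  exact hodgeConjectureFor_of_hodgeConjecture' h C

end Summit.HodgeConjecture.HodgeConjecture.Ring2.Motiv
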